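import Mathlib
import Literature.NumberTheory.Automorphic.FuchsianEisensteinTruncationPairings
import Literature.NumberTheory.Automorphic.FuchsianCuspFormsCompact
import Literature.NumberTheory.Automorphic.SelbergTransformStrip

/-!
# The tails of the Eisenstein series and their defects under the invariant integral operators
(Iwaniec, *Spectral Methods of Automorphic Forms*, GSM 53, §6.1 (6.5)–(6.6) (the inhomogeneous
Fredholm equation: subtracting the contributions of the cuspidal zones), §6.4 (6.29) (truncation),
Theorem 1.16, §2.6 (2.42); PDF pp. 24, 39, 82–83, 88)

Eighteenth brick of the general-`Γ` Eisenstein series, second file of **Chapter 6 (meromorphic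
continuation of `E_𝔞(z, s)`)** for a general finite volume group (towards `Iwaniec2002_eq_12_5` /
`Iwaniec2002_thm_12_1` through `Fuchsian.SpectralParts`). In the resolvent form of Colin de Verdière's
method used here (`FuchsianPseudoCuspForms`, `SelbergTransformStrip`) the Eisenstein series is
written `E_𝔞ᵢ(·, s) = E^Y_𝔞ᵢ(·, s) + θᵢ^s + Σⱼ φᵢⱼ(s) θⱼ^{1-s}` with the TAILS
`θᵢ^w = E_𝔞ᵢ(·|y^w 𝟙_{y>Y})` (incomplete Eisenstein series with cut powers), and the eigen-equation
`(T_k - ĥ_k(s)) E = 0` becomes an inhomogeneous equation for the square-integrable `E^Y` whose right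
side is built from the DEFECTS `aᵢ^w = (T_k - ĥ_k(w)) θᵢ^w`. This file proves what is needed about
tails and defects; everything is PROVED, no fact is introduced.

1. (§1) the invariant height along balls: `y_Γ(w) ≤ e^{d(z,w)} y_Γ(z)` (`invHeight_le_exp_dist_mul`).
2. (§2) `tailEis Γ σ i w Y = θᵢ^w`: automorphic, measurable, `= 0` where `y_Γ ≤ Y`, `= δᵢⱼ (Im u)^w` at
   `γσⱼu`, `Im u > Y ≥ 1` (`tailEis_smul_frame`); the dichotomy `tailEis_cases` (at each point `θᵢ^w`
   is `0` for all `w` or `δᵢⱼ y_Γ^w` for all `w`); the bound `|θᵢ^w| ≤ H^{|Re w|}` where `y_Γ ≤ H`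
   (`norm_tailEis_le`); local integrability.
3. (§3) `tailDefect Γ σ k i w Y = aᵢ^w = L_k θᵢ^w - ĥ_k(w) θᵢ^w`: **deep in the cusps `θᵢ^w` is an
   exact `L_k`-eigenfunction** (`invariantOperator_tailEis_deep`, Theorem 1.16 on the ball carrying
   the kernel), below the collar both terms vanish (`invariantOperator_tailEis_low`), so **`aᵢ^w` is
   supported in the collar `Y e^{-R} < y_Γ ≤ Y e^{R}`** (`tailDefect_eq_zero_of_not_mem_collar`) and
   **bounded by `A_k(w) = (B_k μ(B_R) + |ĥ_k(w)|)(Y e^{2R})^{|Re w|}`** (`norm_tailDefect_le`,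
   `defectBound`, continuous in `w`); automorphic, measurable.
4. (§4) `aᵢ^w ∈ L²(F)` (`memLp_tailDefect`), its class `tailDefectLp`, and **`w ↦ [aᵢ^w] ∈ L²(F)` is
   ENTIRE** (`analyticOnNhd_tailDefectLp`): pointwise holomorphy (`differentiable_tailDefect_apply`,
   holomorphic parametric integrals over the ball where the tails are uniformly bounded) and the
   locally uniform bound, via `Literature.Analysis.Complex.analyticOnNhd_of_locally_bounded`.
5. (§5) for `Re s > 1`: `E_𝔞ᵢ = E^Y_𝔞ᵢ + θᵢ^s + Σⱼ φᵢⱼ(s) θⱼ^{1-s}` (`eisCusp_eq_eisTrunc_add_tails`),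
   `L_k E_𝔞ᵢ(·, s) = ĥ_k(s) E_𝔞ᵢ(·, s)` (`invariantOperator_eisCusp`, Theorem 1.16), additivity of
   `L_k`, and **the resolvent identity**
   `(L_k - ĥ_k(s)) E^Y_𝔞ᵢ(·, s) + aᵢ^s + Σⱼ φᵢⱼ(s) aⱼ^{1-s} = 0` (`resolventIdentity_of_re_gt_one`) —
   Iwaniec's (6.6) with `T_k` in place of the Green function, the starting point of the continuation.

## References
* [Iwaniec2002] H. Iwaniec, *Spectral Methods of Automorphic Forms*, 2nd ed., GSM 53, AMS 2002,
  §6.1 (6.5)–(6.6), PDF pp. 82–83; (6.29), PDF p. 88; Thm 1.16, PDF p. 24; §2.6 (2.42), PDF p. 39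
  (held copy `book:iwaniec2002-spectral-methods-automorphic-forms`).
* [Colindeverdiere1983] Y. Colin de Verdière, *Pseudo-laplaciens II*, Ann. Inst. Fourier 33 (1983) 87–113.

Mathlib: `UpperHalfPlane.im_le_im_mul_exp_dist`, `dist_smul`, `DifferentiableAt.const_cpow`,
`IsCompact.exists_bound_of_continuousOn`, `MemLp.of_bound`, `locallyIntegrable_finsetSum`. Literature:
`cutHigh`, `incEisCusp_cutHigh_horocycle`, `measurable_incEisCusp_cutHigh`, `eisTrunc_eq_decomp`,
`eisCusp_eq_low_add_high` (`FuchsianEisensteinTruncationPairings`); `eisTrunc`, `exists_norm_eisTrunc_le`,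
`measurable_eisTrunc`, `incEisCusp_eq_zero_of_invHeight_le` (`FuchsianEisensteinTruncation`); `invHeight`,
`invHeight_frame_smul`, `invHeight_smul`, `exists_smul_mem_cuspStrip_of_lt`, `invHeight_pos`, `invHeight_of_isEmpty`
(`FuchsianInvariantHeight`); `incEisCusp_smul`, `isAutomorphic_incEisCusp` (`FuchsianIncompleteEisensteinCusp`);
`isC2_and_eigen_eisCusp`, `eisScattering` (`FuchsianEisensteinSeries`, `FuchsianEisensteinConstantTerm`);
`invariantOperator`, `integrable_kernel_mul`, `invariantOperator_const_mul`, `invariantOperator_comp_smul_of_mem_range`,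
`norm_invariantOperator_le` (`InvariantIntegralOperators`); `invariantOperator_eigenfunction`
(`InvariantOperatorEigenfunctions`); `kernelRadius`, `kernel_support_radius`, `continuous_invariantOperator`,
`volume_closedBall_eq` (`CuspFormsCompact`, `CuspidalSubspace`); `eigenvalueFn`, `invariantOperator_im_smul_cpow_eq`,
`differentiable_eigenvalueFn`, `differentiableOn_integral_mul_of_bound` (`SelbergTransformStrip`);
`analyticOnNhd_of_locally_bounded` (`Analysis/Complex/SquareIntegrableHolomorphicFamily`).
-/

noncomputable section

namespace Literature.NumberTheory.Automorphic

namespace Fuchsian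

open _root_.MeasureTheory _root_.Set _root_.Filter _root_.Real _root_.Topology _root_.Metric _root_.UpperHalfPlane
open scoped _root_.ENNReal _root_.NNReal _root_.MatrixGroups _root_.Pointwise

variable {Γ : Subgroup (GL (Fin 2) ℝ)} {F : Set ℍ} {h : ℕ} {𝔞 : Fin h → OnePoint ℝ} {σ : Fin h → SL(2, ℝ)}

/-! ## 1. The invariant height along hyperbolic balls -/

section Height

variable (hΓ : Γ ≤ (Matrix.SpecialLinearGroup.toGL : SL(2, ℝ) →* GL (Fin 2) ℝ).range)
  (hd : IsDiscreteSubgroup Γ)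
  (hper : ∀ i, (ConjAct.toConjAct (Matrix.SpecialLinearGroup.toGL (σ i) : GL (Fin 2) ℝ)⁻¹ • Γ).strictPeriods =
    AddSubgroup.zmultiples 1)

include hΓ hd hper in
/-- **The invariant height grows at most exponentially with the distance**:
`y_Γ(w) ≤ e^{d(z,w)} y_Γ(z)` (each frame map `v ↦ σ_i⁻¹γv` is an isometry and `Im a ≤ e^{d(a,b)} Im b`).
[cite: Iwaniec2002, §2.6 (2.42) & (1.3), PDF pp. 8, 39] -/
theorem invHeight_le_exp_dist_mul (z w : ℍ) : invHeight Γ σ w ≤ Real.exp (dist z w) * invHeight Γ σ z := by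
  rcases isEmpty_or_nonempty (Fin h) with hh | ⟨⟨i₀⟩⟩
  · rw [invHeight_of_isEmpty, invHeight_of_isEmpty, mul_zero]
  refine csSup_le (heightSet_nonempty i₀ w) ?_
  rintro y ⟨i, γ, hγ, rfl⟩
  obtain ⟨g, hg⟩ := hΓ hγ
  set g' : SL(2, ℝ) := (σ i)⁻¹ * g with hg'
  have e : ∀ v : ℍ, ((Matrix.SpecialLinearGroup.toGL (σ i) : GL (Fin 2) ℝ)⁻¹ • γ • v) = g' • v := by
    intro v
    rw [hg', mul_smul, ← hg]
    rfl
  rw [e w]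
  have h1 := im_le_im_mul_exp_dist (g' • w) (g' • z)
  rw [dist_smul, dist_comm] at h1
  have h2 : (g' • z).im ≤ invHeight Γ σ z := by
    rw [← e z]; exact im_frame_smul_le_invHeight hΓ hd hper i hγ z
  calc (g' • w).im ≤ (g' • z).im * Real.exp (dist z w) := h1
    _ ≤ invHeight Γ σ z * Real.exp (dist z w) := mul_le_mul_of_nonneg_right h2 (Real.exp_pos _).le
    _ = Real.exp (dist z w) * invHeight Γ σ z := mul_comm _ _

include hΓ hd hper in
/-- On the ball `B(z, R)`: `y_Γ(w) ≤ e^R y_Γ(z)`. [folklore] -/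
theorem invHeight_le_of_mem_closedBall {z w : ℍ} {R : ℝ} (hw : w ∈ closedBall z R) :
    invHeight Γ σ w ≤ Real.exp R * invHeight Γ σ z := by
  refine (invHeight_le_exp_dist_mul hΓ hd hper z w).trans ?_
  rcases isEmpty_or_nonempty (Fin h) with hh | ⟨⟨i₀⟩⟩
  · rw [invHeight_of_isEmpty, mul_zero, mul_zero]
  · have h0 : 0 ≤ invHeight Γ σ z := (invHeight_pos hΓ hd hper i₀ z).le
    exact mul_le_mul_of_nonneg_right (Real.exp_le_exp.mpr (by rw [dist_comm]; exact mem_closedBall.mp hw)) h0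

end Height

/-! ## 2. The Eisenstein tails `E_𝔞ᵢ(·|y^w 𝟙_{y>Y})`: values, bounds, integrability -/

section Tails

variable (hΓ : Γ ≤ (Matrix.SpecialLinearGroup.toGL : SL(2, ℝ) →* GL (Fin 2) ℝ).range)
  (hneg : (-1 : GL (Fin 2) ℝ) ∈ Γ) (hd : IsDiscreteSubgroup Γ)
  (hinfty : ∀ i, (Matrix.SpecialLinearGroup.toGL (σ i) : GL (Fin 2) ℝ) • (OnePoint.infty : OnePoint ℝ) = 𝔞 i)
  (hper : ∀ i, (ConjAct.toConjAct (Matrix.SpecialLinearGroup.toGL (σ i) : GL (Fin 2) ℝ)⁻¹ • Γ).strictPeriods =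
    AddSubgroup.zmultiples 1)
  (hineq : ∀ i j, ∀ γ ∈ Γ, γ • 𝔞 i = 𝔞 j → i = j)

variable (Γ σ) in
/-- **The Eisenstein tail of the cusp `𝔞ᵢ`**: `θᵢ^w = E_𝔞ᵢ(·|y^w𝟙_{y>Y})`, the automorphic function
equal to `(Im σᵢ⁻¹z)^w` in the cuspidal zone of `𝔞ᵢ` above `Y` and to `0` off its `Γ`-orbit — the
`δ`-part (`w = s`) and the `φ`-parts (`w = 1 - s`) subtracted in the truncation (6.29):
`E_𝔞ᵢ(z, s) = E^Y_𝔞ᵢ(z, s) + θᵢ^s(z) + Σₖ φᵢₖ(s) θₖ^{1-s}(z)`. [cite: Iwaniec2002, (6.29), PDF p. 88] -/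
def tailEis (i : Fin h) (w : ℂ) (Y : ℝ) : ℍ → ℂ := incEisCusp Γ (σ i) (cutHigh w Y)

/-- Unfolding. [folklore] -/
theorem tailEis_def (i : Fin h) (w : ℂ) (Y : ℝ) : tailEis Γ σ i w Y = incEisCusp Γ (σ i) (cutHigh w Y) := rfl

include hΓ in
/-- The tails are automorphic. [cite: Iwaniec2002, §3.2 (3.12), PDF p. 43] -/
theorem isAutomorphic_tailEis (i : Fin h) (w : ℂ) (Y : ℝ) : IsAutomorphic Γ (tailEis Γ σ i w Y) :=
  isAutomorphic_incEisCusp hΓ (σ i) _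

include hΓ hd hper in
/-- The tails are measurable (`Y > 0`). [folklore] -/
theorem measurable_tailEis (i : Fin h) (w : ℂ) {Y : ℝ} (hY : 0 < Y) : Measurable (tailEis Γ σ i w Y) :=
  measurable_incEisCusp_cutHigh hΓ hd hper i w hY

include hΓ hd hper in
/-- **Below the height `Y` the tails vanish**: `y_Γ(z) ≤ Y ⇒ θᵢ^w(z) = 0`. [cite: Iwaniec2002, (6.29), PDF p. 88] -/
theorem tailEis_eq_zero_of_invHeight_le (i : Fin h) (w : ℂ) {Y : ℝ} {z : ℍ} (hz : invHeight Γ σ z ≤ Y) :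
    tailEis Γ σ i w Y z = 0 :=
  incEisCusp_eq_zero_of_invHeight_le hΓ hd hper i (ψ := cutHigh w Y) (fun _ ht => cutHigh_of_le ht) hz

include hΓ hneg hd hinfty hper hineq in
/-- **In the cuspidal zones**: for `Y ≥ 1`, `Im u > Y`, `γ ∈ Γ`,
`θᵢ^w(γ σⱼ u) = δᵢⱼ (Im u)^w`. [cite: Iwaniec2002, (3.16) & (6.29), PDF pp. 44, 88] -/
theorem tailEis_smul_frame (i j : Fin h) (w : ℂ) {Y : ℝ} (hY : 1 ≤ Y) {u : ℍ} (hu : Y < u.im)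
    {γ : GL (Fin 2) ℝ} (hγ : γ ∈ Γ) :
    tailEis Γ σ i w Y (γ • σ j • u) = if i = j then ((u.im : ℝ) : ℂ) ^ w else 0 := by
  rw [tailEis_def, incEisCusp_smul hΓ (σ i) _ hγ]
  have hu0 : 0 < u.im := u.im_pos
  have e : u = (u.re : ℝ) +ᵥ UpperHalfPlane.ofComplex (⟨0, u.im⟩ : ℂ) := by
    apply UpperHalfPlane.ext
    rw [UpperHalfPlane.coe_vadd, UpperHalfPlane.ofComplex_apply_of_im_pos (z := (⟨0, u.im⟩ : ℂ)) hu0]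
    apply Complex.ext <;> simp
  conv_lhs => rw [e]
  exact incEisCusp_cutHigh_horocycle hΓ hneg hd hinfty hper hineq i j w hY hu u.re

include hΓ hneg hd hinfty hper hineq in
/-- **Structure of the tail at a point**: for `Y ≥ 1` and every `z` either `θᵢ^w(z) = 0` for all `w`,
or `z = γ σⱼ u` with `γ ∈ Γ`, `Im u = y_Γ(z) > Y`, and `θᵢ^w(z) = δᵢⱼ y_Γ(z)^w` for all `w`.
[cite: Iwaniec2002, §2.6 (2.42) & (6.29), PDF pp. 39, 88] -/
theorem tailEis_cases (i : Fin h) {Y : ℝ} (hY : 1 ≤ Y) (z : ℍ) :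
    (∀ w, tailEis Γ σ i w Y z = 0) ∨
      (Y < invHeight Γ σ z ∧ ∃ j : Fin h,
        ∀ w, tailEis Γ σ i w Y z = if i = j then ((invHeight Γ σ z : ℝ) : ℂ) ^ w else 0) := by
  by_cases hz : invHeight Γ σ z ≤ Y
  · exact Or.inl fun w => tailEis_eq_zero_of_invHeight_le hΓ hd hper i w hz
  · push Not at hz
    right
    refine ⟨hz, ?_⟩
    obtain ⟨γ, hγ, j, u, hu, e⟩ := exists_smul_mem_cuspStrip_of_lt hper (by linarith) hz
    have huY : Y < u.im := hu.2.2
    -- `z = γ⁻¹ σⱼ u` and `y_Γ(z) = Im u`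
    have ez : z = γ⁻¹ • σ j • u := by
      have := congrArg (fun v => γ⁻¹ • v) e
      simp only [inv_smul_smul] at this
      rw [← this]; rfl
    have hyz : invHeight Γ σ z = u.im := by
      rw [ez, invHeight_smul (Γ.inv_mem hγ)]
      exact invHeight_frame_smul hΓ hneg hd hinfty hper hineq j (by linarith)
    refine ⟨j, fun w => ?_⟩
    rw [hyz, ez, tailEis_smul_frame hΓ hneg hd hinfty hper hineq i j w hY huY (Γ.inv_mem hγ)]

include hΓ hneg hd hinfty hper hineq in
/-- **Bound**: if `y_Γ(z) ≤ H` with `H ≥ 1`, then `|θᵢ^w(z)| ≤ H^{|Re w|}` (`Y ≥ 1`). [folklore] -/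
theorem norm_tailEis_le (i : Fin h) (w : ℂ) {Y : ℝ} (hY : 1 ≤ Y) {H : ℝ} (hH : 1 ≤ H) {z : ℍ}
    (hz : invHeight Γ σ z ≤ H) : ‖tailEis Γ σ i w Y z‖ ≤ H ^ |w.re| := by
  rcases tailEis_cases hΓ hneg hd hinfty hper hineq i hY z with h0 | ⟨hzY, j, hj⟩
  · rw [h0 w, norm_zero]; positivity
  · rw [hj w]
    split_ifs with hij
    · have hy0 : 0 < invHeight Γ σ z := by linarith
      have hy1 : 1 ≤ invHeight Γ σ z := by linarith
      rw [Complex.norm_cpow_eq_rpow_re_of_pos hy0]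
      rcases le_or_gt 0 w.re with hw | hw
      · rw [abs_of_nonneg hw]
        exact Real.rpow_le_rpow hy0.le hz hw
      · rw [abs_of_neg hw]
        calc invHeight Γ σ z ^ w.re ≤ 1 := Real.rpow_le_one_of_one_le_of_nonpos hy1 hw.le
          _ ≤ H ^ (-w.re) := Real.one_le_rpow hH (by linarith)
    · rw [norm_zero]; positivity

include hΓ hneg hd hinfty hper hineq in
/-- The tails are bounded on compact sets, hence **locally integrable**. [folklore] -/
theorem locallyIntegrable_tailEis (i : Fin h) (w : ℂ) {Y : ℝ} (hY : 1 ≤ Y) :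
    LocallyIntegrable (tailEis Γ σ i w Y) := by
  rw [locallyIntegrable_iff]
  intro C hC
  obtain ⟨D, hD⟩ := hC.isBounded.subset_closedBall UpperHalfPlane.I
  haveI : IsFiniteMeasure (volume.restrict C) := ⟨by rw [Measure.restrict_apply_univ]; exact hC.measure_lt_top⟩
  set H : ℝ := max 1 (Real.exp D * invHeight Γ σ UpperHalfPlane.I) with hHdef
  have hH : 1 ≤ H := le_max_left _ _
  have hbound : ∀ z ∈ C, ‖tailEis Γ σ i w Y z‖ ≤ H ^ |w.re| := fun z hz =>
    norm_tailEis_le hΓ hneg hd hinfty hper hineq i w hY hH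
      ((invHeight_le_of_mem_closedBall hΓ hd hper (hD hz)).trans (le_max_right _ _))
  refine MemLp.integrable le_rfl (MemLp.of_bound (p := 1)
    (measurable_tailEis hΓ hd hper i w (by linarith)).aestronglyMeasurable.restrict (H ^ |w.re|) ?_)
  rw [ae_restrict_iff' hC.measurableSet]
  exact Eventually.of_forall hbound

end Tails

/-! ## 3. The invariant integral operators on the tails: `(L_k - ĥ_k(w)) θᵢ^w` lives on a collar -/

section Defect

variable (hΓ : Γ ≤ (Matrix.SpecialLinearGroup.toGL : SL(2, ℝ) →* GL (Fin 2) ℝ).range)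
  (hneg : (-1 : GL (Fin 2) ℝ) ∈ Γ) (hd : IsDiscreteSubgroup Γ)
  (hinfty : ∀ i, (Matrix.SpecialLinearGroup.toGL (σ i) : GL (Fin 2) ℝ) • (OnePoint.infty : OnePoint ℝ) = 𝔞 i)
  (hper : ∀ i, (ConjAct.toConjAct (Matrix.SpecialLinearGroup.toGL (σ i) : GL (Fin 2) ℝ)⁻¹ • Γ).strictPeriods =
    AddSubgroup.zmultiples 1)
  (hineq : ∀ i j, ∀ γ ∈ Γ, γ • 𝔞 i = 𝔞 j → i = j)
  {k : ℝ → ℝ} {M : ℝ}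

variable (Γ σ) in
/-- **The defect of the tail under `T_k`**: `aᵢ^w = L_k θᵢ^w - ĥ_k(w) θᵢ^w` — the inhomogeneity of the
resolvent equation for the truncated Eisenstein series; it vanishes deep in the cusps and below the
collar `Y e^{-R} < y_Γ ≤ Y e^{R}` (`R` the radius of the support of `k`).
[cite: Iwaniec2002, §6.1 (6.5)–(6.6), PDF pp. 82–83] -/
def tailDefect (k : ℝ → ℝ) (i : Fin h) (w : ℂ) (Y : ℝ) (z : ℍ) : ℂ :=
  invariantOperator k (tailEis Γ σ i w Y) z - eigenvalueFn k w * tailEis Γ σ i w Y z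

include hΓ hneg hd hinfty hper hineq in
/-- **Deep in a cusp `θᵢ^w` is an exact eigenfunction of `L_k`**: if `k` is supported in `u ≤ M` and
`Im u > Y e^{R_M}` (`Y ≥ 1`), then `L_k θᵢ^w (γσⱼu) = ĥ_k(w) θᵢ^w(γσⱼu)` for `γ ∈ Γ` and every cusp
`𝔞ⱼ` (on the ball of radius `R_M` about `γσⱼu` the tail is `δᵢⱼ (Im σⱼ⁻¹γ⁻¹·)^w`, Theorem 1.16).
[cite: Iwaniec2002, Thm 1.16 & (6.29), PDF pp. 24, 88] -/
theorem invariantOperator_tailEis_deep (hk : IsTestKernel k) (hM : ∀ u, M ≤ u → k u = 0) (i j : Fin h) (w : ℂ)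
    {Y : ℝ} (hY : 1 ≤ Y) {u : ℍ} (hu : Y * Real.exp (kernelRadius M) < u.im) {γ : GL (Fin 2) ℝ} (hγ : γ ∈ Γ) :
    invariantOperator k (tailEis Γ σ i w Y) (γ • σ j • u) =
      eigenvalueFn k w * tailEis Γ σ i w Y (γ • σ j • u) := by
  set R := kernelRadius M with hR
  have hY0 : 0 < Y := by linarith
  have hR0 : 0 ≤ R := kernelRadius_nonneg M
  have huY : Y < u.im := by
    have : Y * 1 ≤ Y * Real.exp R := mul_le_mul_of_nonneg_left (Real.one_le_exp hR0) hY0.le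
    linarith
  obtain ⟨g, hg⟩ := hΓ hγ
  set g' : SL(2, ℝ) := (σ j)⁻¹ * g⁻¹ with hg'
  set z : ℍ := γ • σ j • u with hzdef
  have ee : ∀ (x : SL(2, ℝ)) (v : ℍ), (Matrix.SpecialLinearGroup.toGL x : GL (Fin 2) ℝ) • v = x • v := fun x v => rfl
  have hgz : g' • z = u := by
    rw [hg', hzdef, ← hg, ee, mul_smul, inv_smul_smul, inv_smul_smul]
  -- on the support of the kernel the tail is the frame power
  have hball : ∀ w' : ℍ, k (pointPairInv z w') ≠ 0 →
      tailEis Γ σ i w Y w' = if i = j then ((((g' • w').im : ℝ) : ℂ)) ^ w else 0 := by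
    intro w' hk0
    have hdist : dist z w' ≤ R := kernel_support_radius hM hk0
    set u' : ℍ := g' • w' with hu'
    have ew' : w' = γ • σ j • u' := by
      rw [hu', hg', ← hg, ee, mul_smul, smul_inv_smul, smul_inv_smul]
    have hdu : dist u u' ≤ R := by rw [← hgz, hu', dist_smul]; exact hdist
    have hu'Y : Y < u'.im := by
      have h1 := im_le_im_mul_exp_dist u u'
      have h2 : u.im ≤ u'.im * Real.exp R := h1.trans (mul_le_mul_of_nonneg_left (Real.exp_le_exp.mpr hdu) u'.im_pos.le)
      by_contra hle
      push Not at hle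
      have : u'.im * Real.exp R ≤ Y * Real.exp R := mul_le_mul_of_nonneg_right hle (Real.exp_pos _).le
      linarith
    rw [ew', tailEis_smul_frame hΓ hneg hd hinfty hper hineq i j w hY hu'Y hγ]
  -- hence the integrals agree
  have hint : invariantOperator k (tailEis Γ σ i w Y) z =
      invariantOperator k (fun w' => if i = j then ((((g' • w').im : ℝ) : ℂ)) ^ w else 0) z := by
    unfold invariantOperator
    refine integral_congr_ae (Eventually.of_forall fun w' => ?_)
    simp only
    by_cases hk0 : k (pointPairInv z w') = 0
    · rw [hk0]; simp
    · rw [hball w' hk0]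
  rw [hint]
  have hz : tailEis Γ σ i w Y z = if i = j then ((u.im : ℝ) : ℂ) ^ w else 0 :=
    tailEis_smul_frame hΓ hneg hd hinfty hper hineq i j w hY huY hγ
  rw [hz]
  split_ifs with hij
  · rw [invariantOperator_im_smul_cpow_eq hk g' w z, hgz]
  · unfold invariantOperator
    simp

include hΓ hd hper in
/-- **Below the collar both `L_k θᵢ^w` and `θᵢ^w` vanish**: if `y_Γ(z) e^{R_M} ≤ Y` then
`L_k θᵢ^w(z) = 0`. [cite: Iwaniec2002, (6.29), PDF p. 88] -/
theorem invariantOperator_tailEis_low (hM : ∀ u, M ≤ u → k u = 0) (i : Fin h) (w : ℂ) {Y : ℝ} {z : ℍ}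
    (hz : Real.exp (kernelRadius M) * invHeight Γ σ z ≤ Y) : invariantOperator k (tailEis Γ σ i w Y) z = 0 := by
  unfold invariantOperator
  have : (fun w' : ℍ => (k (pointPairInv z w') : ℂ) * tailEis Γ σ i w Y w') = fun _ => 0 := by
    funext w'
    by_cases hk0 : k (pointPairInv z w') = 0
    · rw [hk0]; simp
    · have hdist : dist z w' ≤ kernelRadius M := kernel_support_radius hM hk0
      have hle : invHeight Γ σ w' ≤ Y :=
        (invHeight_le_of_mem_closedBall hΓ hd hper (mem_closedBall.mpr (by rw [dist_comm]; exact hdist))).trans hz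
      rw [tailEis_eq_zero_of_invHeight_le hΓ hd hper i w hle, mul_zero]
  rw [this, integral_zero]

include hΓ hneg hd hinfty hper hineq in
/-- **The defect is supported in the collar** `Y e^{-R_M} < y_Γ(z) ≤ Y e^{R_M}` (`Y ≥ 1`).
[cite: Iwaniec2002, §6.1 (6.5)–(6.6) & (6.29), PDF pp. 82–83, 88] -/
theorem tailDefect_eq_zero_of_not_mem_collar (hk : IsTestKernel k) (hM : ∀ u, M ≤ u → k u = 0) (i : Fin h)
    (w : ℂ) {Y : ℝ} (hY : 1 ≤ Y) {z : ℍ}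
    (hz : Real.exp (kernelRadius M) * invHeight Γ σ z ≤ Y ∨ Y * Real.exp (kernelRadius M) < invHeight Γ σ z) :
    tailDefect Γ σ k i w Y z = 0 := by
  unfold tailDefect
  rcases hz with hlow | hhigh
  · have h1 := invariantOperator_tailEis_low hΓ hd hper hM i w hlow
    have h2 : invHeight Γ σ z ≤ Y := by
      have : invHeight Γ σ z ≤ Real.exp (kernelRadius M) * invHeight Γ σ z := by
        rcases isEmpty_or_nonempty (Fin h) with hh | ⟨⟨i₀⟩⟩
        · rw [invHeight_of_isEmpty, mul_zero]
        · exact le_mul_of_one_le_left (invHeight_pos hΓ hd hper i₀ z).le (Real.one_le_exp (kernelRadius_nonneg M))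
      exact this.trans hlow
    rw [h1, tailEis_eq_zero_of_invHeight_le hΓ hd hper i w h2, mul_zero, sub_zero]
  · have hY0 : (0 : ℝ) ≤ Y * Real.exp (kernelRadius M) := by positivity
    obtain ⟨γ, hγ, j, u, hu, e⟩ := exists_smul_mem_cuspStrip_of_lt hper hY0 hhigh
    have ez : z = γ⁻¹ • σ j • u := by
      have := congrArg (fun v => γ⁻¹ • v) e
      simp only [inv_smul_smul] at this
      rw [← this]; rfl
    rw [ez, invariantOperator_tailEis_deep hΓ hneg hd hinfty hper hineq hk hM i j w hY hu.2.2 (Γ.inv_mem hγ), sub_self]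

/-- The constant bounding the defect: `A_k(w) = (B_k μ(B(i, R_M)) + |ĥ_k(w)|) (Y e^{2R_M})^{|Re w|}`,
`B_k = sup|k|`. [folklore] -/
def defectBound (k : ℝ → ℝ) (Bk M : ℝ) (w : ℂ) (Y : ℝ) : ℝ :=
  (Bk * (volume (closedBall UpperHalfPlane.I (kernelRadius M))).toReal + ‖eigenvalueFn k w‖) *
    (Y * Real.exp (2 * kernelRadius M)) ^ |w.re|

/-- `A_k(w) ≥ 0` for `B_k ≥ 0`, `Y ≥ 0`. [folklore] -/
theorem defectBound_nonneg (k : ℝ → ℝ) {Bk : ℝ} (hBk : 0 ≤ Bk) (M : ℝ) (w : ℂ) {Y : ℝ} (hY : 0 ≤ Y) :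
    0 ≤ defectBound k Bk M w Y := by
  unfold defectBound; positivity

/-- `A_k(w)` is continuous in `w`. [folklore] -/
theorem continuous_defectBound (hk : IsTestKernel k) (Bk M : ℝ) {Y : ℝ} (hY : 1 ≤ Y) :
    Continuous fun w => defectBound k Bk M w Y := by
  unfold defectBound
  refine Continuous.mul (continuous_const.add (continuous_eigenvalueFn hk).norm) ?_
  have hb : (Y * Real.exp (2 * kernelRadius M)) ≠ 0 := by positivity
  exact (Real.continuous_const_rpow hb).comp (continuous_abs.comp Complex.continuous_re)

include hΓ hneg hd hinfty hper hineq in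
/-- **The defect is bounded**: `|aᵢ^w(z)| ≤ A_k(w)` everywhere (`|k| ≤ B_k`, `Y ≥ 1`).
[cite: Iwaniec2002, §6.1 (6.5), PDF p. 82] -/
theorem norm_tailDefect_le (hk : IsTestKernel k) {Bk : ℝ} (hBk : ∀ u, |k u| ≤ Bk) (hM : ∀ u, M ≤ u → k u = 0)
    (i : Fin h) (w : ℂ) {Y : ℝ} (hY : 1 ≤ Y) (z : ℍ) : ‖tailDefect Γ σ k i w Y z‖ ≤ defectBound k Bk M w Y := by
  set R := kernelRadius M with hR
  have hR0 : 0 ≤ R := kernelRadius_nonneg M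
  have hBk0 : 0 ≤ Bk := (abs_nonneg _).trans (hBk 0)
  have hY0 : 0 < Y := by linarith
  by_cases hz : Real.exp R * invHeight Γ σ z ≤ Y ∨ Y * Real.exp R < invHeight Γ σ z
  · rw [tailDefect_eq_zero_of_not_mem_collar hΓ hneg hd hinfty hper hineq hk hM i w hY hz, norm_zero]
    exact defectBound_nonneg k hBk0 M w hY0.le
  · push Not at hz
    obtain ⟨-, hzle⟩ := hz
    -- heights on the ball are `≤ H = Y e^{2R}`
    set H : ℝ := Y * Real.exp (2 * R) with hH
    have hH1 : 1 ≤ H := by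
      have := Real.one_le_exp (by positivity : (0 : ℝ) ≤ 2 * R)
      rw [hH]; nlinarith
    have hHball : ∀ w' ∈ closedBall z R, invHeight Γ σ w' ≤ H := by
      intro w' hw'
      calc invHeight Γ σ w' ≤ Real.exp R * invHeight Γ σ z := invHeight_le_of_mem_closedBall hΓ hd hper hw'
        _ ≤ Real.exp R * (Y * Real.exp R) := mul_le_mul_of_nonneg_left hzle (Real.exp_pos _).le
        _ = H := by rw [hH, two_mul, Real.exp_add]; ring
    have hzH : invHeight Γ σ z ≤ H := hHball z (mem_closedBall_self hR0)
    -- the integral term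
    have hloc := locallyIntegrable_tailEis hΓ hneg hd hinfty hper hineq i w hY
    have h1 : ‖invariantOperator k (tailEis Γ σ i w Y) z‖ ≤ Bk * ((volume (closedBall UpperHalfPlane.I R)).toReal * H ^ |w.re|) := by
      refine (norm_invariantOperator_le hBk hM hloc z).trans ?_
      rw [show 2 * Real.arsinh (Real.sqrt M) = R from rfl]
      refine mul_le_mul_of_nonneg_left ?_ hBk0
      have hvol : volume (closedBall z R) < ∞ := volume_closedBall_lt_top z R
      calc (∫ w' in closedBall z R, ‖tailEis Γ σ i w Y w'‖)
          ≤ ∫ _ in closedBall z R, H ^ |w.re| := by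
            refine setIntegral_mono_on (hloc.integrableOn_isCompact (isCompact_closedBall z R)).norm
              (integrableOn_const hvol.ne) measurableSet_closedBall fun w' hw' => ?_
            exact norm_tailEis_le hΓ hneg hd hinfty hper hineq i w hY hH1 (hHball w' hw')
        _ = (volume (closedBall UpperHalfPlane.I R)).toReal * H ^ |w.re| := by
            rw [setIntegral_const, smul_eq_mul, Measure.real, volume_closedBall_eq z R]
    have h2 : ‖eigenvalueFn k w * tailEis Γ σ i w Y z‖ ≤ ‖eigenvalueFn k w‖ * H ^ |w.re| := by
      rw [norm_mul]
      exact mul_le_mul_of_nonneg_left (norm_tailEis_le hΓ hneg hd hinfty hper hineq i w hY hH1 hzH) (norm_nonneg _)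
    unfold tailDefect defectBound
    calc ‖invariantOperator k (tailEis Γ σ i w Y) z - eigenvalueFn k w * tailEis Γ σ i w Y z‖
        ≤ ‖invariantOperator k (tailEis Γ σ i w Y) z‖ + ‖eigenvalueFn k w * tailEis Γ σ i w Y z‖ := norm_sub_le _ _
      _ ≤ Bk * ((volume (closedBall UpperHalfPlane.I R)).toReal * H ^ |w.re|) + ‖eigenvalueFn k w‖ * H ^ |w.re| :=
          add_le_add h1 h2
      _ = (Bk * (volume (closedBall UpperHalfPlane.I R)).toReal + ‖eigenvalueFn k w‖) * H ^ |w.re| := by ring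

include hΓ in
/-- The defect is automorphic. [folklore] -/
theorem isAutomorphic_tailDefect (k : ℝ → ℝ) (i : Fin h) (w : ℂ) (Y : ℝ) : IsAutomorphic Γ (tailDefect Γ σ k i w Y) := by
  intro γ hγ z
  unfold tailDefect
  have h1 : invariantOperator k (tailEis Γ σ i w Y) (γ • z) = invariantOperator k (tailEis Γ σ i w Y) z := by
    rw [← invariantOperator_comp_smul_of_mem_range k _ (hΓ hγ) z]
    congr 1
    funext v
    exact isAutomorphic_tailEis hΓ i w Y γ hγ v
  rw [h1, isAutomorphic_tailEis hΓ i w Y γ hγ z]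

include hΓ hneg hd hinfty hper hineq in
/-- The defect is measurable (for a Lipschitz kernel: `L_k θ` is continuous). [folklore] -/
theorem measurable_tailDefect (hk : IsTestKernel k) {L : ℝ≥0} (hL : LipschitzWith L k) (hM : ∀ u, M ≤ u → k u = 0)
    (i : Fin h) (w : ℂ) {Y : ℝ} (hY : 1 ≤ Y) : Measurable (tailDefect Γ σ k i w Y) := by
  unfold tailDefect
  have hc : Continuous (invariantOperator k (tailEis Γ σ i w Y)) :=
    continuous_invariantOperator hk hL hM (locallyIntegrable_tailEis hΓ hneg hd hinfty hper hineq i w hY)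
  exact hc.measurable.sub ((measurable_tailEis hΓ hd hper i w (by linarith)).const_mul _)

end Defect

/-! ## 4. The defects as holomorphic `L²(F)`-valued functions of `w` -/

section Analytic

variable (hΓ : Γ ≤ (Matrix.SpecialLinearGroup.toGL : SL(2, ℝ) →* GL (Fin 2) ℝ).range)
  (hneg : (-1 : GL (Fin 2) ℝ) ∈ Γ) (hd : IsDiscreteSubgroup Γ) (hF : IsHypFundamentalDomain Γ F)
  (hvol : volume F < ⊤)
  (hinfty : ∀ i, (Matrix.SpecialLinearGroup.toGL (σ i) : GL (Fin 2) ℝ) • (OnePoint.infty : OnePoint ℝ) = 𝔞 i)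
  (hper : ∀ i, (ConjAct.toConjAct (Matrix.SpecialLinearGroup.toGL (σ i) : GL (Fin 2) ℝ)⁻¹ • Γ).strictPeriods =
    AddSubgroup.zmultiples 1)
  (hineq : ∀ i j, ∀ γ ∈ Γ, γ • 𝔞 i = 𝔞 j → i = j)
  {k : ℝ → ℝ} {L : ℝ≥0} {M Bk : ℝ}

include hΓ hneg hd hvol hinfty hper hineq in
/-- **The defect is square-integrable on `F`** (bounded, finite volume). [folklore] -/
theorem memLp_tailDefect (hk : IsTestKernel k) (hL : LipschitzWith L k) (hBk : ∀ u, |k u| ≤ Bk)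
    (hM : ∀ u, M ≤ u → k u = 0) (i : Fin h) (w : ℂ) {Y : ℝ} (hY : 1 ≤ Y) :
    MemLp (tailDefect Γ σ k i w Y) 2 (volume.restrict F) := by
  haveI : IsFiniteMeasure (volume.restrict F) := isFiniteMeasure_restrict.mpr hvol.ne
  exact MemLp.of_bound (measurable_tailDefect hΓ hneg hd hinfty hper hineq hk hL hM i w hY).aestronglyMeasurable _
    (Eventually.of_forall (norm_tailDefect_le hΓ hneg hd hinfty hper hineq hk hBk hM i w hY))

variable (Γ F σ) in
/-- **The class of the defect in `L²(F)`** (zero when the defect is not square-integrable, which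
does not happen under the standing hypotheses). [folklore] -/
def tailDefectLp (k : ℝ → ℝ) (i : Fin h) (w : ℂ) (Y : ℝ) : Lp ℂ 2 (volume.restrict F) := by
  classical
  exact if hmem : MemLp (tailDefect Γ σ k i w Y) 2 (volume.restrict F) then hmem.toLp _ else 0

/-- The class is represented by the defect. [folklore] -/
theorem tailDefectLp_eq_toLp {i : Fin h} {w : ℂ} {Y : ℝ} (hmem : MemLp (tailDefect Γ σ k i w Y) 2 (volume.restrict F)) :
    tailDefectLp Γ F σ k i w Y = hmem.toLp _ := by
  unfold tailDefectLp
  rw [dif_pos hmem]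

/-- The class is represented by the defect, a.e. form. [folklore] -/
theorem tailDefectLp_coeFn {i : Fin h} {w : ℂ} {Y : ℝ} (hmem : MemLp (tailDefect Γ σ k i w Y) 2 (volume.restrict F)) :
    (tailDefectLp Γ F σ k i w Y : ℍ → ℂ) =ᵐ[volume.restrict F] tailDefect Γ σ k i w Y := by
  rw [tailDefectLp_eq_toLp hmem]
  exact MemLp.coeFn_toLp hmem

include hΓ hneg hd hinfty hper hineq in
/-- **Pointwise holomorphy of the tail in `w`**: `w ↦ θᵢ^w(z)` is entire (it is `0` or `δᵢⱼ y_Γ(z)^w`).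
[folklore] -/
theorem differentiable_tailEis_apply (i : Fin h) {Y : ℝ} (hY : 1 ≤ Y) (z : ℍ) :
    Differentiable ℂ fun w => tailEis Γ σ i w Y z := by
  rcases tailEis_cases hΓ hneg hd hinfty hper hineq i hY z with h0 | ⟨hzY, j, hj⟩
  · simp_rw [h0]; exact differentiable_const _
  · simp_rw [hj]
    split_ifs with hij
    · have hc : ((invHeight Γ σ z : ℝ) : ℂ) ≠ 0 := by
        rw [Ne, Complex.ofReal_eq_zero]; linarith
      exact differentiable_id.const_cpow (Or.inl hc)
    · exact differentiable_const _

include hΓ hneg hd hinfty hper hineq in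
/-- **Pointwise holomorphy of `L_k θᵢ^w(z)` in `w`** (holomorphic parametric integral over the ball
carrying the kernel, where the tails are uniformly bounded). [folklore] -/
theorem differentiable_invariantOperator_tailEis_apply (hk : IsTestKernel k) (hM : ∀ u, M ≤ u → k u = 0)
    (i : Fin h) {Y : ℝ} (hY : 1 ≤ Y) (z : ℍ) :
    Differentiable ℂ fun w => invariantOperator k (tailEis Γ σ i w Y) z := by
  set R := kernelRadius M with hR
  have hR0 : 0 ≤ R := kernelRadius_nonneg M
  set B : Set ℍ := closedBall z R with hB
  -- the kernel as an integrable weight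
  set φ : ℍ → ℂ := fun w' => (k (pointPairInv z w') : ℂ) with hφ
  have hφi : Integrable φ := by
    have := integrable_kernel_mul hk (locallyIntegrable_const (1 : ℂ)) z
    simpa [hφ] using this
  -- the truncated family
  set G : ℂ → ℍ → ℂ := fun w w' => B.indicator (tailEis Γ σ i w Y) w' with hG
  have heq : ∀ w, invariantOperator k (tailEis Γ σ i w Y) z = ∫ w', φ w' * G w w' := by
    intro w
    unfold invariantOperator
    refine integral_congr_ae (Eventually.of_forall fun w' => ?_)
    simp only [hφ, hG]
    by_cases hmem : w' ∈ B
    · rw [indicator_of_mem hmem]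
    · rw [indicator_of_notMem hmem, mul_zero]
      have : k (pointPairInv z w') = 0 := by
        by_contra hk0
        exact hmem (mem_closedBall.mpr (by rw [dist_comm]; exact kernel_support_radius hM hk0))
      rw [this]; simp
  have hfun : (fun w => invariantOperator k (tailEis Γ σ i w Y) z) = fun w => ∫ w', φ w' * G w w' := funext heq
  rw [hfun]
  -- heights on the ball
  set H : ℝ := max 1 (Real.exp R * invHeight Γ σ z) with hH
  have hH1 : 1 ≤ H := le_max_left _ _
  have hHball : ∀ w' ∈ B, invHeight Γ σ w' ≤ H := fun w' hw' =>
    (invHeight_le_of_mem_closedBall hΓ hd hper hw').trans (le_max_right _ _)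
  -- differentiability on each ball `ball w₀ 1`
  intro w₀
  have hU : IsOpen (ball w₀ (1 : ℝ)) := isOpen_ball
  have hdiffG : ∀ w', DifferentiableOn ℂ (fun w => G w w') (ball w₀ 1) := by
    intro w'
    by_cases hmem : w' ∈ B
    · simp only [hG, indicator_of_mem hmem]
      exact (differentiable_tailEis_apply hΓ hneg hd hinfty hper hineq i hY w').differentiableOn
    · simp only [hG, indicator_of_notMem hmem]
      exact differentiableOn_const _
  have hmeasG : ∀ w ∈ ball w₀ (1 : ℝ), AEStronglyMeasurable (G w) volume := fun w _ =>
    ((measurable_tailEis hΓ hd hper i w (by linarith)).indicator measurableSet_closedBall).aestronglyMeasurable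
  have hboundG : ∀ w ∈ ball w₀ (1 : ℝ), ∀ w', ‖G w w'‖ ≤ H ^ (|w₀.re| + 1) := by
    intro w hw w'
    by_cases hmem : w' ∈ B
    · simp only [hG, indicator_of_mem hmem]
      refine (norm_tailEis_le hΓ hneg hd hinfty hper hineq i w hY hH1 (hHball w' hmem)).trans ?_
      refine Real.rpow_le_rpow_of_exponent_le hH1 ?_
      have h1 : |w.re - w₀.re| ≤ 1 := by
        have h2 : ‖w - w₀‖ < 1 := by rw [← dist_eq_norm]; exact mem_ball.mp hw
        have h3 : |(w - w₀).re| ≤ ‖w - w₀‖ := Complex.abs_re_le_norm _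
        rw [Complex.sub_re] at h3
        linarith
      have := abs_sub_abs_le_abs_sub w.re w₀.re
      linarith
    · simp only [hG, indicator_of_notMem hmem, norm_zero]
      positivity
  exact (differentiableOn_integral_mul_of_bound hφi hU hdiffG hmeasG hboundG w₀ (mem_ball_self one_pos)).differentiableAt
    (hU.mem_nhds (mem_ball_self one_pos))

include hΓ hneg hd hinfty hper hineq in
/-- **Pointwise holomorphy of the defect `aᵢ^w(z)` in `w`.** [folklore] -/
theorem differentiable_tailDefect_apply (hk : IsTestKernel k) (hM : ∀ u, M ≤ u → k u = 0)
    (i : Fin h) {Y : ℝ} (hY : 1 ≤ Y) (z : ℍ) : Differentiable ℂ fun w => tailDefect Γ σ k i w Y z := by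
  unfold tailDefect
  exact (differentiable_invariantOperator_tailEis_apply hΓ hneg hd hinfty hper hineq hk hM i hY z).sub
    ((differentiable_eigenvalueFn hk).mul (differentiable_tailEis_apply hΓ hneg hd hinfty hper hineq i hY z))

include hΓ hneg hd hvol hinfty hper hineq in
/-- **The defect classes `w ↦ [aᵢ^w] ∈ L²(F)` are entire** (pointwise holomorphy and locally uniform
bounds, `Literature.Analysis.Complex.analyticOnNhd_of_locally_bounded`). This holomorphy is what
makes the resolvent construction of Chapter 6 produce MEROMORPHIC continuations. [folklore] -/
theorem analyticOnNhd_tailDefectLp (hk : IsTestKernel k) (hL : LipschitzWith L k) (hBk : ∀ u, |k u| ≤ Bk)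
    (hM : ∀ u, M ≤ u → k u = 0) (i : Fin h) {Y : ℝ} (hY : 1 ≤ Y) :
    AnalyticOnNhd ℂ (fun w => tailDefectLp Γ F σ k i w Y) univ := by
  haveI : IsFiniteMeasure (volume.restrict F) := isFiniteMeasure_restrict.mpr hvol.ne
  refine Literature.Analysis.Complex.analyticOnNhd_of_locally_bounded (μ := volume.restrict F) isOpen_univ
    (f := fun w z => tailDefect Γ σ k i w Y z) (fun z => (differentiable_tailDefect_apply hΓ hneg hd hinfty hper hineq hk hM i hY z).differentiableOn)
    (fun w _ => (measurable_tailDefect hΓ hneg hd hinfty hper hineq hk hL hM i w hY).aestronglyMeasurable) ?_ ?_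
  · intro w₀ _
    have hcont := continuous_defectBound hk Bk M hY
    obtain ⟨C, hC⟩ := (isCompact_closedBall w₀ (1 : ℝ)).exists_bound_of_continuousOn hcont.continuousOn
    refine ⟨closedBall w₀ 1, closedBall_mem_nhds w₀ one_pos, C, fun w hw z => ?_⟩
    refine (norm_tailDefect_le hΓ hneg hd hinfty hper hineq hk hBk hM i w hY z).trans ?_
    have := hC w hw
    rw [Real.norm_eq_abs] at this
    exact (le_abs_self _).trans this
  · intro w _
    exact tailDefectLp_coeFn (memLp_tailDefect hΓ hneg hd hvol hinfty hper hineq hk hL hBk hM i w hY)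

end Analytic

/-! ## 5. `E_𝔞ᵢ(z, s) = E^Y_𝔞ᵢ(z, s) + θᵢ^s(z) + Σₖ φᵢₖ(s) θₖ^{1-s}(z)` and the resolvent identity for `Re s > 1` -/

section Decomposition

variable (hΓ : Γ ≤ (Matrix.SpecialLinearGroup.toGL : SL(2, ℝ) →* GL (Fin 2) ℝ).range)
  (hneg : (-1 : GL (Fin 2) ℝ) ∈ Γ) (hd : IsDiscreteSubgroup Γ) (hF : IsHypFundamentalDomain Γ F)
  (hvol : volume F < ⊤)
  (hinfty : ∀ i, (Matrix.SpecialLinearGroup.toGL (σ i) : GL (Fin 2) ℝ) • (OnePoint.infty : OnePoint ℝ) = 𝔞 i)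
  (hper : ∀ i, (ConjAct.toConjAct (Matrix.SpecialLinearGroup.toGL (σ i) : GL (Fin 2) ℝ)⁻¹ • Γ).strictPeriods =
    AddSubgroup.zmultiples 1)
  (hineq : ∀ i j, ∀ γ ∈ Γ, γ • 𝔞 i = 𝔞 j → i = j)
  (hcomplete : ∀ c : OnePoint ℝ, IsCusp c Γ → ∃ i, ∃ γ ∈ Γ, γ • 𝔞 i = c)
  {k : ℝ → ℝ} {M : ℝ}

include hΓ hd hper in
/-- **The decomposition of the Eisenstein series into its truncation and tails**: for `Re s > 1`,
`Y > 0`, `E_𝔞ᵢ(z, s) = E^Y_𝔞ᵢ(z, s) + θᵢ^s(z) + Σₖ φᵢₖ(s) θₖ^{1-s}(z)`.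
[cite: Iwaniec2002, (6.29), PDF p. 88] -/
theorem eisCusp_eq_eisTrunc_add_tails (i : Fin h) {s : ℂ} (hs : 1 < s.re) {Y : ℝ} (hY : 0 < Y) (z : ℍ) :
    eisCusp Γ (σ i) z s = eisTrunc Γ σ i s Y z + tailEis Γ σ i s Y z +
      ∑ j, eisScattering Γ σ i j s * tailEis Γ σ j (1 - s) Y z := by
  rw [eisTrunc_eq_decomp hΓ hd hper i hs hY z, eisCusp_eq_low_add_high hΓ hd (σ i) (hper i) hs hY z]
  simp only [tailEis]
  ring

/-- `1/4 + t² = s(1 - s)` for `t = -i(s - 1/2)`. [folklore] -/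
theorem quarter_add_specParam_sq (s : ℂ) : (1 / 4 : ℂ) + (-Complex.I * (s - 1 / 2)) ^ 2 = s * (1 - s) := by
  have hI : Complex.I * Complex.I = -1 := Complex.I_mul_I
  linear_combination (s - 1 / 2) ^ 2 * hI

include hΓ hd hper in
/-- **`L_k E_𝔞ᵢ(·, s) = ĥ_k(s) E_𝔞ᵢ(·, s)`** for `Re s > 1` (Theorem 1.16: `E ∈ 𝒜_s`). [cite: Iwaniec2002, Thm 1.16 & (3.11), PDF pp. 24, 43] -/
theorem invariantOperator_eisCusp (hk : IsTestKernel k) (i : Fin h) {s : ℂ} (hs : 1 < s.re) (z : ℍ) :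
    invariantOperator k (fun v => eisCusp Γ (σ i) v s) z = eigenvalueFn k s * eisCusp Γ (σ i) z s := by
  obtain ⟨-, hC2, heig⟩ := isC2_and_eigen_eisCusp hΓ hd (σ i) (upperRightHom_one_mem_of_periods (hper i)) hs
  have heig' : ∀ v, hypLaplacian (fun v => eisCusp Γ (σ i) v s) v +
      (1 / 4 + (-Complex.I * (s - 1 / 2)) ^ 2) * eisCusp Γ (σ i) v s = 0 := by
    intro v; rw [quarter_add_specParam_sq]; exact heig v
  exact invariantOperator_eigenfunction hk hC2 _ heig' z

/-- **Bounded measurable functions on `ℍ` are locally integrable.** [folklore] -/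
theorem locallyIntegrable_of_bounded {f : ℍ → ℂ} (hfm : Measurable f) {B : ℝ} (hB : ∀ z, ‖f z‖ ≤ B) :
    LocallyIntegrable f := by
  rw [locallyIntegrable_iff]
  intro C hC
  haveI : IsFiniteMeasure (volume.restrict C) := ⟨by rw [Measure.restrict_apply_univ]; exact hC.measure_lt_top⟩
  exact MemLp.integrable le_rfl (MemLp.of_bound (p := 1) hfm.aestronglyMeasurable.restrict B (Eventually.of_forall hB))

/-- **Additivity of `L_k`** (both integrals converging). [folklore] -/
theorem invariantOperator_add (hk : IsTestKernel k) {f g : ℍ → ℂ} (hf : LocallyIntegrable f) (hg : LocallyIntegrable g) (z : ℍ) :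
    invariantOperator k (fun v => f v + g v) z = invariantOperator k f z + invariantOperator k g z := by
  unfold invariantOperator
  rw [← integral_add (integrable_kernel_mul hk hf z) (integrable_kernel_mul hk hg z)]
  refine integral_congr_ae (Eventually.of_forall fun v => ?_)
  simp only; ring

/-- **`L_k` of a finite sum.** [folklore] -/
theorem invariantOperator_finset_sum (hk : IsTestKernel k) {ι : Type*} (S : Finset ι) {f : ι → ℍ → ℂ}
    (hf : ∀ i ∈ S, LocallyIntegrable (f i)) (z : ℍ) :
    invariantOperator k (fun v => ∑ i ∈ S, f i v) z = ∑ i ∈ S, invariantOperator k (f i) z := by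
  classical
  induction S using Finset.induction_on with
  | empty => simp [invariantOperator]
  | insert a S ha ih =>
    have hfa : LocallyIntegrable (f a) := hf a (Finset.mem_insert_self a S)
    have hS : ∀ i ∈ S, LocallyIntegrable (f i) := fun i hi => hf i (Finset.mem_insert_of_mem hi)
    have hsum : LocallyIntegrable (fun v => ∑ i ∈ S, f i v) :=
      locallyIntegrable_finsetSum S (fun i hi => hS i hi)
    simp_rw [Finset.sum_insert ha]
    rw [invariantOperator_add hk hfa hsum z, ih hS]

include hΓ hneg hd hF hvol hinfty hper hineq hcomplete in
/-- **The truncated Eisenstein series is locally integrable** (bounded and measurable, `Re s > 1`,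
`Y ≥ 1`). [folklore] -/
theorem locallyIntegrable_eisTrunc {s : ℂ} (hs : 1 < s.re) (i : Fin h) {Y : ℝ} (hY : 1 ≤ Y) :
    LocallyIntegrable (eisTrunc Γ σ i s Y) := by
  obtain ⟨B, hB⟩ := exists_norm_eisTrunc_le hΓ hneg hd hF hvol hinfty hper hineq hcomplete hs i hY
  exact locallyIntegrable_of_bounded (measurable_eisTrunc hΓ hd hper hs i (by linarith)) hB

include hΓ hneg hd hF hvol hinfty hper hineq hcomplete in
/-- **The resolvent identity for `Re s > 1`** (the inhomogeneous equation of §6.1 with `T_k` in place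
of the Green function): with `aᵢ^w = (L_k - ĥ_k(w))θᵢ^w`,
`(L_k - ĥ_k(s)) E^Y_𝔞ᵢ(·, s) + aᵢ^s + Σⱼ φᵢⱼ(s) aⱼ^{1-s} = 0` pointwise — `(L_k - ĥ_k(s)) E_𝔞ᵢ(·, s) = 0`
expanded along `E = E^Y + θᵢ^s + Σⱼ φᵢⱼ θⱼ^{1-s}`. [cite: Iwaniec2002, §6.1 (6.6), PDF p. 83] -/
theorem resolventIdentity_of_re_gt_one (hk : IsTestKernel k) (i : Fin h) {s : ℂ} (hs : 1 < s.re) {Y : ℝ}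
    (hY : 1 ≤ Y) (z : ℍ) :
    (invariantOperator k (eisTrunc Γ σ i s Y) z - eigenvalueFn k s * eisTrunc Γ σ i s Y z) +
        tailDefect Γ σ k i s Y z + ∑ j, eisScattering Γ σ i j s * tailDefect Γ σ k j (1 - s) Y z = 0 := by
  have hY0 : 0 < Y := by linarith
  have hdec : (fun v => eisCusp Γ (σ i) v s) = fun v => eisTrunc Γ σ i s Y v +
      (tailEis Γ σ i s Y v + ∑ j, eisScattering Γ σ i j s * tailEis Γ σ j (1 - s) Y v) := by
    funext v
    rw [eisCusp_eq_eisTrunc_add_tails hΓ hd hper i hs hY0 v]; ring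
  have hE := invariantOperator_eisCusp hΓ hd hper hk i hs z
  -- local integrability of the pieces
  have h1 := locallyIntegrable_eisTrunc hΓ hneg hd hF hvol hinfty hper hineq hcomplete hs i hY
  have h2 : LocallyIntegrable (tailEis Γ σ i s Y) := locallyIntegrable_tailEis hΓ hneg hd hinfty hper hineq i s hY
  have h3 : ∀ j ∈ Finset.univ, LocallyIntegrable (fun v => eisScattering Γ σ i j s * tailEis Γ σ j (1 - s) Y v) :=
    fun j _ => (locallyIntegrable_tailEis hΓ hneg hd hinfty hper hineq j (1 - s) hY).smul (eisScattering Γ σ i j s)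
  have h23 : LocallyIntegrable (fun v => tailEis Γ σ i s Y v + ∑ j, eisScattering Γ σ i j s * tailEis Γ σ j (1 - s) Y v) :=
    h2.add (locallyIntegrable_finsetSum Finset.univ h3)
  rw [hdec, invariantOperator_add hk h1 h23, invariantOperator_add hk h2 (locallyIntegrable_finsetSum Finset.univ h3),
    invariantOperator_finset_sum hk Finset.univ h3] at hE
  simp_rw [invariantOperator_const_mul] at hE
  rw [eisCusp_eq_eisTrunc_add_tails hΓ hd hper i hs hY0 z] at hE
  unfold tailDefect
  have e : ∑ j, eisScattering Γ σ i j s * (invariantOperator k (tailEis Γ σ j (1 - s) Y) z -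
      eigenvalueFn k s * tailEis Γ σ j (1 - s) Y z) =
      ∑ j, eisScattering Γ σ i j s * invariantOperator k (tailEis Γ σ j (1 - s) Y) z -
        eigenvalueFn k s * ∑ j, eisScattering Γ σ i j s * tailEis Γ σ j (1 - s) Y z := by
    rw [Finset.mul_sum, ← Finset.sum_sub_distrib]
    refine Finset.sum_congr rfl fun j _ => ?_; ring
  have e1 : eigenvalueFn k (1 - s) = eigenvalueFn k s := by
    unfold eigenvalueFn
    have : -Complex.I * (1 - s - 1 / 2) = -(-Complex.I * (s - 1 / 2)) := by ring
    rw [this, selbergTransform_neg]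
  simp_rw [e1]
  rw [e]
  linear_combination hE

end Decomposition

end Fuchsian

end Literature.NumberTheory.Automorphic
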